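import Summits.Ventures.HSemireg.WedgePair

/-!
# Venture HSemireg — THEOREM T (point pair, 2/2): ranges and the rank 2·C(n,k) − [k=0] − [k=n]

HONEST FRAMING. Part of the Lean index of the computation cell `pub-hsemireg` (seat p3; Sunday enclosure of the
FORMULA-N kernel assets of seats th-7 / th-6, ENCLOSURE-PLAN-p3.md).  Finite-dimensional exterior algebra over a field ONLY:
no variety, no cohomology theory, no semiregularity map is constructed here; nothing here says that HC / HC_CM / HC_AV holds;
no Literature fact is declared or used.  The geometric DICTIONARY (why these ranks are the `HT`-side box ranks of the cell's
STRUCTURE.md §1 / theory/FORMULA-N.md) lives in theory/FORMULA-N-th7.md PART B §A.3 / §N and is NOT asserted in Lean.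

THEOREM T, the point-pair case, file 2 of 2 (th-7 PointPairRank.lean l.249–465): `range_eq_span_Tset` (for `0 < k < n` the range of
`θ ↦ θ ∧ (a E_X + c E_Y)` on `⋀^k` is the span of the monomials indexed by `Tset n k` — the two K-isotypic pieces), `range_eq_span_top`
(`k = n`), `range_eq_span_self` (`k = 0`), and **`finrank_range_wedgeMap_pointPair (hn : 0 < n) (hk : k ≤ n) (ha : a ≠ 0) (hc : c ≠ 0) :
finrank (range (wedgeMap k (pointPair a c))) = pointPairRank n k`**, `pointPairRank n k := 2·C(n,k) − [k = 0] − [k = n] = [t^k](2(1+t)ⁿ − 1 − tⁿ)`.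
= p4's tree theorem `ContractionSpan.finrank_span_pointIdeal` (degree 2, n ≥ 3) under the §N.5 dictionary; = th-6's typed
`PointPairLawAt` after the reindexing glue (`WedgePairGlue.lean`).  th-7's statements and proofs, unchanged.
-/

open Module Set Set.powersetCard

namespace Summit.Ventures.HSemireg.WedgePair

variable (K : Type*) [Field K] {n : ℕ}

/-- For `0 < k < n` the range of `θ ↦ θ ∧ (a E_X + c E_Y)` on `⋀^k` is the span of the monomials
indexed by `Tset n k`. -/
theorem range_eq_span_Tset {k : ℕ} (hk0 : 0 < k) {a c : K} (ha : a ≠ 0) (hc : c ≠ 0) :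
    LinearMap.range (wedgeMap K n k (pointPair K n a c)) =
      Submodule.span K (Set.range fun t : (Tset n k : Set (Finset (I n))) => B K n (t : Finset (I n))) := by
  apply le_antisymm
  · rw [range_wedgeMap, Submodule.span_le]
    rintro _ ⟨s, rfl⟩
    change B K n s * pointPair K n a c ∈ _
    rw [B_mul_pointPair]
    by_cases hX : Disjoint s.val (Xset n)
    · have hsY : s.val ⊆ Yset n := disjoint_X_iff_subset_Y.mp hX
      have hY : ¬ Disjoint s.val (Ypc n).val :=
        not_disjoint_of_subset_of_nonempty hsY (nonempty_of_pc hk0 s)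
      rw [B_mul_of_disjoint K s (Xpc n) hX, B_mul_of_not_disjoint K s (Ypc n) hY, smul_zero, add_zero]
      refine Submodule.smul_mem _ _ (units_smul_mem K _ (Submodule.subset_span ?_))
      refine ⟨⟨(disjUnion (s := s) (t := Xpc n) hX : Finset (I n)), ?_⟩, rfl⟩
      rw [Finset.mem_coe, coe_disjUnion_eq_union, coe_Xpc]
      exact mem_Tset_of_subset_Y hsY (card_eq s)
    · by_cases hY : Disjoint s.val (Yset n)
      · have hsX : s.val ⊆ Xset n := disjoint_Y_iff_subset_X.mp hY
        rw [B_mul_of_not_disjoint K s (Xpc n) hX, B_mul_of_disjoint K s (Ypc n) hY, smul_zero, zero_add]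
        refine Submodule.smul_mem _ _ (units_smul_mem K _ (Submodule.subset_span ?_))
        refine ⟨⟨(disjUnion (s := s) (t := Ypc n) hY : Finset (I n)), ?_⟩, rfl⟩
        rw [Finset.mem_coe, coe_disjUnion_eq_union, coe_Ypc]
        exact mem_Tset_of_subset_X hsX (card_eq s)
      · rw [B_mul_of_not_disjoint K s (Xpc n) hX, B_mul_of_not_disjoint K s (Ypc n) hY, smul_zero,
          smul_zero, add_zero]
        exact Submodule.zero_mem _
  · rw [Submodule.span_le]
    rintro _ ⟨⟨t, ht⟩, rfl⟩
    change B K n t ∈ LinearMap.range (wedgeMap K n k (pointPair K n a c))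
    rw [Finset.mem_coe, Tset, Finset.mem_union, Finset.mem_image, Finset.mem_image] at ht
    rcases ht with ⟨s, hs, rfl⟩ | ⟨s, hs, rfl⟩
    · obtain ⟨hsY, hsc⟩ := Finset.mem_powersetCard.mp hs
      let sp : powersetCard (I n) k := ⟨s, by rw [mem_iff]; exact hsc⟩
      have hX : Disjoint sp.val (Xpc n).val := disjoint_X_iff_subset_Y.mpr hsY
      have hY : ¬ Disjoint sp.val (Ypc n).val :=
        not_disjoint_of_subset_of_nonempty hsY (nonempty_of_pc hk0 sp)
      have h1 : wedgeMap K n k (pointPair K n a c) ⟨B K n sp, B_mem_exteriorPower K sp⟩ ∈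
          LinearMap.range (wedgeMap K n k (pointPair K n a c)) := LinearMap.mem_range_self _ _
      have h2 : wedgeMap K n k (pointPair K n a c) ⟨B K n sp, B_mem_exteriorPower K sp⟩ =
          a • ((permOfDisjoint hX).sign • B K n (s ∪ Xset n)) := by
        rw [wedgeMap_apply, Subtype.coe_mk, B_mul_pointPair, B_mul_of_disjoint K sp (Xpc n) hX,
          B_mul_of_not_disjoint K sp (Ypc n) hY, smul_zero, add_zero, coe_disjUnion_eq_union]
        rfl
      have h3 : B K n (s ∪ Xset n) =
          (permOfDisjoint hX).sign • (a⁻¹ • wedgeMap K n k (pointPair K n a c)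
            ⟨B K n sp, B_mem_exteriorPower K sp⟩) := by
        rw [h2, smul_smul, inv_mul_cancel₀ ha, one_smul, units_smul_smul_self]
      rw [h3]
      exact units_smul_mem K _ (Submodule.smul_mem _ _ h1)
    · obtain ⟨hsX, hsc⟩ := Finset.mem_powersetCard.mp hs
      let sp : powersetCard (I n) k := ⟨s, by rw [mem_iff]; exact hsc⟩
      have hY : Disjoint sp.val (Ypc n).val := disjoint_Y_iff_subset_X.mpr hsX
      have hX : ¬ Disjoint sp.val (Xpc n).val :=
        not_disjoint_of_subset_of_nonempty hsX (nonempty_of_pc hk0 sp)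
      have h1 : wedgeMap K n k (pointPair K n a c) ⟨B K n sp, B_mem_exteriorPower K sp⟩ ∈
          LinearMap.range (wedgeMap K n k (pointPair K n a c)) := LinearMap.mem_range_self _ _
      have h2 : wedgeMap K n k (pointPair K n a c) ⟨B K n sp, B_mem_exteriorPower K sp⟩ =
          c • ((permOfDisjoint hY).sign • B K n (s ∪ Yset n)) := by
        rw [wedgeMap_apply, Subtype.coe_mk, B_mul_pointPair, B_mul_of_not_disjoint K sp (Xpc n) hX,
          B_mul_of_disjoint K sp (Ypc n) hY, smul_zero, zero_add, coe_disjUnion_eq_union]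
        rfl
      have h3 : B K n (s ∪ Yset n) =
          (permOfDisjoint hY).sign • (c⁻¹ • wedgeMap K n k (pointPair K n a c)
            ⟨B K n sp, B_mem_exteriorPower K sp⟩) := by
        rw [h2, smul_smul, inv_mul_cancel₀ hc, one_smul, units_smul_smul_self]
      rw [h3]
      exact units_smul_mem K _ (Submodule.smul_mem _ _ h1)

/-- **THEOREM T, point-pair case, middle degrees**: for `0 < k < n` the rank is `2·C(n,k)`. -/
theorem finrank_range_wedgeMap_pointPair_mid {k : ℕ} (hk0 : 0 < k) (hkn : k < n) {a c : K}
    (ha : a ≠ 0) (hc : c ≠ 0) :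
    Module.finrank K (LinearMap.range (wedgeMap K n k (pointPair K n a c))) = 2 * n.choose k := by
  rw [range_eq_span_Tset K hk0 ha hc]
  have hli : LinearIndependent K (fun t : (Tset n k : Set (Finset (I n))) => B K n (t : Finset (I n))) :=
    (B K n).linearIndependent.comp (fun t : (Tset n k : Set (Finset (I n))) => (t : Finset (I n)))
      Subtype.val_injective
  rw [finrank_span_eq_card hli, ← card_Tset hkn]
  simp

/-! ### The extreme degrees `k = n` and `k = 0` (the two «−1» corrections of `P_n`). -/

/-- `s ∪ X = univ` forces `s = Y` (for `s ⊆ Y`). -/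
lemma union_X_eq_univ_of_subset_Y {s : Finset (I n)} (hsY : s ⊆ Yset n) (hsc : s.card = n) :
    s ∪ Xset n = Finset.univ := by
  apply Finset.eq_univ_of_card
  rw [Finset.card_union_of_disjoint (disjoint_X_iff_subset_Y.mpr hsY), hsc, card_Xset, Fintype.card_fin]

/-- `s ∪ Y = univ` forces `s = X` (for `s ⊆ X`). -/
lemma union_Y_eq_univ_of_subset_X {s : Finset (I n)} (hsX : s ⊆ Xset n) (hsc : s.card = n) :
    s ∪ Yset n = Finset.univ := by
  apply Finset.eq_univ_of_card
  rw [Finset.card_union_of_disjoint (disjoint_Y_iff_subset_X.mpr hsX), hsc, card_Yset, Fintype.card_fin]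

/-- For `k = n ≥ 1` the range is the line through the top monomial `E_{X ∪ Y}`. -/
theorem range_eq_span_top (hn : 0 < n) {a c : K} (ha : a ≠ 0) :
    LinearMap.range (wedgeMap K n n (pointPair K n a c)) = K ∙ B K n (Finset.univ : Finset (I n)) := by
  apply le_antisymm
  · rw [range_wedgeMap, Submodule.span_le]
    rintro _ ⟨s, rfl⟩
    change B K n s * pointPair K n a c ∈ _
    rw [B_mul_pointPair, SetLike.mem_coe]
    by_cases hX : Disjoint s.val (Xset n)
    · have hsY : s.val ⊆ Yset n := disjoint_X_iff_subset_Y.mp hX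
      have hY : ¬ Disjoint s.val (Ypc n).val :=
        not_disjoint_of_subset_of_nonempty hsY (nonempty_of_pc hn s)
      rw [B_mul_of_disjoint K s (Xpc n) hX, B_mul_of_not_disjoint K s (Ypc n) hY, smul_zero, add_zero,
        coe_disjUnion_eq_union, coe_Xpc, union_X_eq_univ_of_subset_Y hsY (card_eq s)]
      exact Submodule.smul_mem _ _ (units_smul_mem K _ (Submodule.mem_span_singleton_self _))
    · by_cases hY : Disjoint s.val (Yset n)
      · have hsX : s.val ⊆ Xset n := disjoint_Y_iff_subset_X.mp hY
        rw [B_mul_of_not_disjoint K s (Xpc n) hX, B_mul_of_disjoint K s (Ypc n) hY, smul_zero, zero_add,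
          coe_disjUnion_eq_union, coe_Ypc, union_Y_eq_univ_of_subset_X hsX (card_eq s)]
        exact Submodule.smul_mem _ _ (units_smul_mem K _ (Submodule.mem_span_singleton_self _))
      · rw [B_mul_of_not_disjoint K s (Xpc n) hX, B_mul_of_not_disjoint K s (Ypc n) hY, smul_zero,
          smul_zero, add_zero]
        exact Submodule.zero_mem _
  · rw [Submodule.span_le, Set.singleton_subset_iff, SetLike.mem_coe]
    have hX : Disjoint (Ypc n).val (Xpc n).val := (disjoint_XY n).symm
    have hY : ¬ Disjoint (Ypc n).val (Ypc n).val :=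
      not_disjoint_of_subset_of_nonempty (subset_refl _) (nonempty_of_pc hn (Ypc n))
    have h1 : wedgeMap K n n (pointPair K n a c) ⟨B K n (Ypc n), B_mem_exteriorPower K (Ypc n)⟩ ∈
        LinearMap.range (wedgeMap K n n (pointPair K n a c)) := LinearMap.mem_range_self _ _
    have h2 : wedgeMap K n n (pointPair K n a c) ⟨B K n (Ypc n), B_mem_exteriorPower K (Ypc n)⟩ =
        a • ((permOfDisjoint hX).sign • B K n (Finset.univ : Finset (I n))) := by
      rw [wedgeMap_apply, Subtype.coe_mk, B_mul_pointPair, B_mul_of_disjoint K (Ypc n) (Xpc n) hX,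
        B_mul_of_not_disjoint K (Ypc n) (Ypc n) hY, smul_zero, add_zero, coe_disjUnion_eq_union,
        coe_Xpc, coe_Ypc, union_X_eq_univ_of_subset_Y (subset_refl _) (card_Yset n)]
    have h3 : B K n (Finset.univ : Finset (I n)) =
        (permOfDisjoint hX).sign • (a⁻¹ • wedgeMap K n n (pointPair K n a c)
          ⟨B K n (Ypc n), B_mem_exteriorPower K (Ypc n)⟩) := by
      rw [h2, smul_smul, inv_mul_cancel₀ ha, one_smul, units_smul_smul_self]
    rw [h3]
    exact units_smul_mem K _ (Submodule.smul_mem _ _ h1)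

/-- **THEOREM T, point-pair case, top degree**: for `k = n ≥ 1` the rank is `1`
(the two top images `E_Y ∧ E_X`, `E_X ∧ E_Y` lie on ONE line — the «−tⁿ» of `P_n`). -/
theorem finrank_range_wedgeMap_pointPair_top (hn : 0 < n) {a c : K} (ha : a ≠ 0) :
    Module.finrank K (LinearMap.range (wedgeMap K n n (pointPair K n a c))) = 1 := by
  rw [range_eq_span_top K hn ha]
  exact finrank_span_singleton ((B K n).ne_zero _)

/-- the empty monomial is `1`. -/
lemma B_empty : B K n (∅ : Finset (I n)) = 1 := by
  rw [B, ExteriorAlgebra.basis_apply_ofCard (b K n) (Finset.card_empty)]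
  simp [ExteriorAlgebra.ιMulti_family]

/-- the point-pair class `a·E_X + c·E_Y` is non-zero for `a ≠ 0`. -/
lemma pointPair_ne_zero (hn : 0 < n) {a c : K} (ha : a ≠ 0) : pointPair K n a c ≠ 0 := by
  intro h
  have hXY : (Xset n) ≠ (Yset n) := by
    intro hxy
    have hd := disjoint_XY n
    rw [hxy, disjoint_self, Finset.bot_eq_empty] at hd
    have := card_Yset n
    rw [hd, Finset.card_empty] at this
    omega
  have hrepr := congrArg (fun x => (B K n).repr x (Xset n)) h
  simp only [pointPair, coe_Xpc, coe_Ypc, map_add, map_smul, Basis.repr_self, Finsupp.coe_add,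
    Finsupp.coe_smul, Pi.add_apply, Pi.smul_apply, Finsupp.single_eq_same,
    Finsupp.single_eq_of_ne hXY, smul_eq_mul, mul_one, mul_zero, add_zero, map_zero,
    Finsupp.coe_zero, Pi.zero_apply] at hrepr
  exact ha hrepr

/-- For `k = 0` the range is the line through the class itself. -/
theorem range_eq_span_self {a c : K} :
    LinearMap.range (wedgeMap K n 0 (pointPair K n a c)) = K ∙ pointPair K n a c := by
  rw [range_wedgeMap]
  have hs : ∀ s : powersetCard (I n) 0, (B K n s : HT K n) * pointPair K n a c = pointPair K n a c := by
    intro s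
    have h0 : (s : Finset (I n)) = ∅ := Finset.card_eq_zero.mp (card_eq s)
    have h1 : B K n (s : Finset (I n)) = 1 := by rw [h0]; exact B_empty K
    rw [h1, one_mul]
  apply le_antisymm
  · rw [Submodule.span_le]
    rintro _ ⟨s, rfl⟩
    rw [SetLike.mem_coe]
    change B K n s * pointPair K n a c ∈ _
    rw [hs s]
    exact Submodule.mem_span_singleton_self _
  · rw [Submodule.span_le, Set.singleton_subset_iff, SetLike.mem_coe]
    let s0 : powersetCard (I n) 0 := ⟨∅, by rw [mem_iff, Finset.card_empty]⟩
    have := hs s0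
    exact Submodule.subset_span ⟨s0, this⟩

/-- **THEOREM T, point-pair case, degree 0**: the rank is `1` (the «−1» of `P_n`). -/
theorem finrank_range_wedgeMap_pointPair_zero (hn : 0 < n) {a c : K} (ha : a ≠ 0) :
    Module.finrank K (LinearMap.range (wedgeMap K n 0 (pointPair K n a c))) = 1 := by
  rw [range_eq_span_self K]
  exact finrank_span_singleton (pointPair_ne_zero K hn ha)

/-! ### The closed form `[t^k] P_n(t)`, `P_n(t) = 2(1+t)^n − 1 − t^n`. -/

variable (n) in
/-- `r_k(n) = 2·C(n,k) − [k = 0] − [k = n]` = the coefficient of `t^k` in `2(1+t)^n − 1 − t^n`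
(= th-6's `transversePairRank`). -/
def pointPairRank (k : ℕ) : ℕ :=
  2 * n.choose k - (if k = 0 then 1 else 0) - (if k = n then 1 else 0)

/-- **THEOREM T (FORMULA-N PART A §2.2 / PART B §A.3) for the point pair `a·1 + c·pt` in the wedge
model, all `n ≥ 1`, all `k ≤ n`**: the rank of `θ ↦ θ ∧ (a·E_X + c·E_Y)` on `⋀^k(K^{2n})` is
`2·C(n,k) − [k = 0] − [k = n]`. Kernel-checked; finite-dimensional linear algebra only. -/
theorem finrank_range_wedgeMap_pointPair (hn : 0 < n) {k : ℕ} (hk : k ≤ n) {a c : K}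
    (ha : a ≠ 0) (hc : c ≠ 0) :
    Module.finrank K (LinearMap.range (wedgeMap K n k (pointPair K n a c))) = pointPairRank n k := by
  rcases Nat.eq_zero_or_pos k with rfl | hk0
  · rw [finrank_range_wedgeMap_pointPair_zero K hn ha, pointPairRank]
    have : (0 : ℕ) ≠ n := by omega
    simp [this]
  · rcases lt_or_eq_of_le hk with hkn | rfl
    · rw [finrank_range_wedgeMap_pointPair_mid K hk0 hkn ha hc, pointPairRank]
      have h1 : k ≠ 0 := by omega
      have h2 : k ≠ n := by omega
      simp [h1, h2]
    · rw [finrank_range_wedgeMap_pointPair_top K hn ha, pointPairRank]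
      have h1 : k ≠ 0 := by omega
      simp [h1]

end Summit.Ventures.HSemireg.WedgePair
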